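import Mathlib
import HarnessLib

/-!
# Reduced echelon bases of subspaces of `kⁿ`

Topic `LinearAlgebra/Matrix`; namespace `Literature.Echelon`. Everything here is proved (Mathlib only).

For a field `k` and a subspace `V ≤ kⁿ` (`Submodule k (Fin n → k)`) there are a unique set of
**pivots** `S ⊆ Fin n` and a unique coefficient table `a : Fin n → Fin n → k` supported on
`{(i, j) : i < j, i ∉ S, j ∈ S}` such that `V` is spanned by the **echelon vectors**
`v_j = e_j + ∑_{i < j, i ∉ S} a_{ij} e_i`, `j ∈ S` (`exists_isEchelonData_span_eq`,
`IsEchelonData.unique`); the `v_j` are linearly independent and `#S = dim V`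
(`exists_echelon_basis`). This is the reduced (column) echelon form of Gaussian elimination, in
the convention "pivot = last non-zero coordinate, normalised to `1`, zeros at the other pivots"
(Hoffman–Kunze, *Linear Algebra*, 2nd ed., §§1.4, 2.5: existence and uniqueness of the
row-reduced echelon matrix row-equivalent to a given one — transposed and with the coordinate
order reversed). Mathlib has `Matrix.Pivot` (two-sided reduction to diagonal form by
transvections) and bases of subspaces (`Basis.ofVectorSpace`), but no one-sided echelon normal
form (checked: `lean search 'echelon|Echelon'`: no hits).

## Use

The immediate consumer is the explicit transversal of the Hecke double coset
`GL_n(𝒪) diag(ϖ 1_r, 1_{n-r}) GL_n(𝒪) / GL_n(𝒪)` over a non-archimedean local field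
(`{u_a ϖ^ε}`: lattices `ϖ𝒪ⁿ ⊆ L ⊆ 𝒪ⁿ` correspond to subspaces of `(𝒪/ϖ)ⁿ`, whose reduced echelon
bases lift to the representatives `u_a ϖ^ε`), used in the unramified computation of
Rankin–Selberg integrals (Jacquet–Shalika 1981, §2) via Shintani's formula
(`Literature/RingTheory/SymmetricFunctions/SchurPolynomials.lean`).

## Main statements

* `echelonVec a j`, `IsEchelonData S a`; `IsEchelonData.echelonVec_apply_of_mem` (pivot
  property `v_j(j') = δ_{jj'}`), `IsEchelonData.linearIndependent`;
* `exists_isEchelonData_span_eq`, `exists_echelon_basis` (existence, by induction on `n` through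
  `restrictLast`/`extendLast`/`liftData`);
* `IsEchelonData.mem_iff` (pivots are intrinsic), `IsEchelonData.eq_zero_of_forall_pivot`,
  `IsEchelonData.unique` (uniqueness).
-/

noncomputable section

open Finset

namespace Literature.LinearAlgebra.Matrix.Echelon

variable {k : Type*} [Field k] {n : ℕ}

/-- The **echelon vector** `v_j = e_j + ∑_{i ≠ j} a_{ij} e_i` attached to a coefficient table `a`
and a pivot `j` (the diagonal value `a_{jj}` is ignored). [folklore] -/
def echelonVec (a : Fin n → Fin n → k) (j : Fin n) : Fin n → k :=
  fun i => if i = j then 1 else a i j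

/-- `v_j(j) = 1`. [folklore] -/
@[simp] theorem echelonVec_apply_self (a : Fin n → Fin n → k) (j : Fin n) :
    echelonVec a j j = 1 := by
  simp [echelonVec]

/-- `v_j(i) = a_{ij}` for `i ≠ j`. [folklore] -/
theorem echelonVec_apply_of_ne (a : Fin n → Fin n → k) {i j : Fin n} (h : i ≠ j) :
    echelonVec a j i = a i j := by
  simp [echelonVec, h]

/-- **Reduced (column) echelon data**: pivots `S` and a coefficient table `a` supported on `{(i,
j) : i < j, i ∉ S, j ∈ S}` — the vector `v_j` (`j ∈ S`) has a `1` at its pivot `j`, zeros at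
the other pivots and below `j`; this is the reduced echelon form with pivot = last non-zero
coordinate (Hoffman–Kunze, *Linear Algebra*, §2.5, row-reduced echelon matrices, transposed
and reversed). [folklore] -/
def IsEchelonData (S : Finset (Fin n)) (a : Fin n → Fin n → k) : Prop :=
  ∀ i j, a i j ≠ 0 → i < j ∧ i ∉ S ∧ j ∈ S

/-- Pivot rows carry no coefficients: `a_{ij} = 0` for `i ∈ S`. [folklore] -/
theorem IsEchelonData.apply_eq_zero_of_mem {S : Finset (Fin n)} {a : Fin n → Fin n → k}
    (h : IsEchelonData S a) {i : Fin n} (hi : i ∈ S) (j : Fin n) : a i j = 0 := by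
  by_contra hne
  exact (h i j hne).2.1 hi

/-- Coefficients sit strictly above the pivot: `a_{ij} = 0` for `j ≤ i`. [folklore] -/
theorem IsEchelonData.apply_eq_zero_of_le {S : Finset (Fin n)} {a : Fin n → Fin n → k}
    (h : IsEchelonData S a) {i j : Fin n} (hij : j ≤ i) : a i j = 0 := by
  by_contra hne
  exact absurd (h i j hne).1 (not_lt.mpr hij)

/-- **Pivot property**: `v_j(j') = δ_{jj'}` for every pivot `j'`. [folklore] -/
theorem IsEchelonData.echelonVec_apply_of_mem {S : Finset (Fin n)} {a : Fin n → Fin n → k}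
    (h : IsEchelonData S a) (j : Fin n) {j' : Fin n} (hj' : j' ∈ S) :
    echelonVec a j j' = if j' = j then 1 else 0 := by
  by_cases hjj : j' = j
  · simp [hjj]
  · rw [echelonVec_apply_of_ne a hjj, if_neg hjj, h.apply_eq_zero_of_mem hj']

/-- The echelon vectors `v_j`, `j ∈ S`, are linearly independent (read off the pivot coordinates).
[folklore] -/
theorem IsEchelonData.linearIndependent {S : Finset (Fin n)} {a : Fin n → Fin n → k}
    (h : IsEchelonData S a) : LinearIndependent k (fun j : S => echelonVec a j) := by
  rw [linearIndependent_iff']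
  intro s g hg j hj
  have := congrFun hg (j : Fin n)
  simp only [Finset.sum_apply, Pi.smul_apply, smul_eq_mul, Pi.zero_apply] at this
  rw [Finset.sum_eq_single j] at this
  · simpa using this
  · intro j' _ hj'
    rw [h.echelonVec_apply_of_mem _ j.2, if_neg (fun e => hj' (Subtype.ext e.symm)), mul_zero]
  · intro hjs
    exact absurd hj hjs

/-! ### Passing from `n` to `n + 1` -/

/-- Restriction `k^{n+1} → kⁿ` to the first `n` coordinates (`x ↦ x ∘ Fin.castSucc`). [folklore] -/
def restrictLast (n : ℕ) : (Fin (n + 1) → k) →ₗ[k] (Fin n → k) :=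
  LinearMap.funLeft k k Fin.castSucc

/-- `restrictLast` evaluates at `Fin.castSucc i`. [folklore] -/
@[simp] theorem restrictLast_apply (x : Fin (n + 1) → k) (i : Fin n) :
    restrictLast n x i = x (Fin.castSucc i) := rfl

/-- Extension by zero `kⁿ → k^{n+1}` in the last coordinate (`Fin.snoc x 0`), as a linear map.
[folklore] -/
def extendLast (n : ℕ) : (Fin n → k) →ₗ[k] (Fin (n + 1) → k) where
  toFun x := Fin.snoc x 0
  map_add' x y := by
    ext i
    refine Fin.lastCases ?_ (fun i => ?_) i <;> simp
  map_smul' c x := by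
    ext i
    refine Fin.lastCases ?_ (fun i => ?_) i <;> simp

/-- `extendLast x (castSucc i) = x i`. [folklore] -/
@[simp] theorem extendLast_apply_castSucc (x : Fin n → k) (i : Fin n) :
    extendLast n x (Fin.castSucc i) = x i := by
  simp [extendLast]

/-- `extendLast x (last) = 0`. [folklore] -/
@[simp] theorem extendLast_apply_last (x : Fin n → k) : extendLast n x (Fin.last n) = 0 := by
  simp [extendLast]

/-- A vector vanishing at the last coordinate is the extension of its restriction. [folklore] -/
theorem extendLast_restrictLast {x : Fin (n + 1) → k} (hx : x (Fin.last n) = 0) :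
    extendLast n (restrictLast n x) = x := by
  ext i
  refine Fin.lastCases ?_ (fun i => ?_) i
  · rw [extendLast_apply_last, hx]
  · simp

/-- Lift of a coefficient table from `n` to `n + 1` coordinates (zero in the last row and column).
[folklore] -/
def liftData (a : Fin n → Fin n → k) : Fin (n + 1) → Fin (n + 1) → k :=
  fun i j => if h : (i : ℕ) < n ∧ (j : ℕ) < n then a ⟨i, h.1⟩ ⟨j, h.2⟩ else 0

/-- `liftData a (castSucc i) (castSucc j) = a i j`. [folklore] -/
theorem liftData_castSucc (a : Fin n → Fin n → k) (i j : Fin n) :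
    liftData a (Fin.castSucc i) (Fin.castSucc j) = a i j := by
  simp [liftData, i.is_lt, j.is_lt]

/-- The last row of `liftData a` is zero. [folklore] -/
theorem liftData_last_left (a : Fin n → Fin n → k) (j : Fin (n + 1)) :
    liftData a (Fin.last n) j = 0 := by
  simp [liftData]

/-- The last column of `liftData a` is zero. [folklore] -/
theorem liftData_last_right (a : Fin n → Fin n → k) (i : Fin (n + 1)) :
    liftData a i (Fin.last n) = 0 := by
  simp [liftData]

/-- Extending an echelon vector by zero gives the echelon vector of the lifted table. [folklore] -/
theorem extendLast_echelonVec (a : Fin n → Fin n → k) (j : Fin n) :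
    extendLast n (echelonVec a j) = echelonVec (liftData a) (Fin.castSucc j) := by
  ext i
  refine Fin.lastCases ?_ (fun i => ?_) i
  · rw [extendLast_apply_last, echelonVec_apply_of_ne _ (Fin.castSucc_lt_last j).ne',
      liftData_last_left]
  · rw [extendLast_apply_castSucc]
    by_cases hij : i = j
    · subst hij; simp
    · rw [echelonVec_apply_of_ne _ hij,
        echelonVec_apply_of_ne _ (fun h => hij (Fin.castSucc_injective _ h)), liftData_castSucc]

/-! ### Existence of reduced echelon bases -/

/-- Echelon data lift from `kⁿ` to `k^{n+1}` (pivots `castSucc '' S`). [folklore] -/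
theorem IsEchelonData.lift {S : Finset (Fin n)} {a : Fin n → Fin n → k} (h : IsEchelonData S a) :
    IsEchelonData (S.map Fin.castSuccEmb) (Echelon.liftData a) := by
  intro i j hij
  by_cases hh : (i : ℕ) < n ∧ (j : ℕ) < n
  · have hij' : a ⟨i, hh.1⟩ ⟨j, hh.2⟩ ≠ 0 := by simpa [Echelon.liftData, hh] using hij
    obtain ⟨h1, h2, h3⟩ := h ⟨i, hh.1⟩ ⟨j, hh.2⟩ hij'
    refine ⟨h1, ?_, ?_⟩
    · intro hi
      rw [Finset.mem_map] at hi
      obtain ⟨i', hi', hii'⟩ := hi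
      apply h2
      have e : (⟨(i : ℕ), hh.1⟩ : Fin n) = i' := by
        ext
        simp [← hii']
      rw [e]
      exact hi'
    · rw [Finset.mem_map]
      exact ⟨⟨j, hh.2⟩, h3, Fin.ext (by simp)⟩
  · exact absurd (by simp [Echelon.liftData, hh]) hij

/-- **Existence of a reduced echelon basis.** Every subspace `V ≤ kⁿ` (`k` a field) is the span of
echelon vectors `v_j = e_j + ∑_{i < j, i ∉ S} a_{ij} e_i`, `j ∈ S`, for some pivot set `S` and
some table `a` supported on `{(i, j) : i < j, i ∉ S, j ∈ S}` (Gaussian elimination;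
Hoffman–Kunze §2.5 / any linear algebra text). Proof by induction on `n`, splitting off the
last coordinate: if `V` has a vector with last coordinate `1`, reduce it against the pivots of
`V ∩ {x_last = 0}` and add `last` as a new pivot. [folklore] -/
theorem exists_isEchelonData_span_eq :
    ∀ (n : ℕ) (V : Submodule k (Fin n → k)), ∃ (S : Finset (Fin n)) (a : Fin n → Fin n → k),
      IsEchelonData S a ∧ Submodule.span k (echelonVec a '' (S : Set (Fin n))) = V := by
  intro n
  induction n with
  | zero =>
    intro V
    refine ⟨∅, fun _ _ => 0, fun i j h => absurd rfl h, ?_⟩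
    rw [Finset.coe_empty, Set.image_empty, Submodule.span_empty]
    exact (Submodule.eq_bot_of_subsingleton).symm
  | succ n ih =>
    intro V
    -- the part of `V` vanishing at the last coordinate, restricted to `kⁿ`
    set Vker : Submodule k (Fin (n + 1) → k) := V ⊓ LinearMap.ker (LinearMap.proj (Fin.last n))
      with hVker
    obtain ⟨S₀, a₀, hd₀, hV₀⟩ := ih (Vker.map (restrictLast n))
    -- `Vker = span (extend '' (echelonVec a₀ '' S₀))`
    have hmemker : ∀ x, x ∈ Vker ↔ x ∈ V ∧ x (Fin.last n) = 0 := fun x => by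
      simp [hVker]
    have hker_span : Vker = Submodule.span k
        (echelonVec (liftData a₀) ''
          ((S₀.map Fin.castSuccEmb : Finset _) : Set (Fin (n + 1)))) := by
      have h1 : Vker = (Vker.map (restrictLast n)).map (extendLast n) := by
        apply le_antisymm
        · intro x hx
          have hx0 := ((hmemker x).mp hx).2
          exact ⟨restrictLast n x, ⟨x, hx, rfl⟩, extendLast_restrictLast hx0⟩
        · rintro _ ⟨_, ⟨x, hx, rfl⟩, rfl⟩
          rw [extendLast_restrictLast ((hmemker x).mp hx).2]
          exact hx
      rw [h1, ← hV₀, Submodule.map_span, ← Set.image_comp]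
      congr 1
      ext y
      simp only [Set.mem_image, Function.comp_apply, Finset.coe_map, Finset.mem_coe,
        Fin.coe_castSuccEmb]
      constructor
      · rintro ⟨j, hj, rfl⟩
        exact ⟨Fin.castSucc j, ⟨j, hj, rfl⟩, (extendLast_echelonVec a₀ j).symm⟩
      · rintro ⟨_, ⟨j, hj, rfl⟩, rfl⟩
        exact ⟨j, hj, extendLast_echelonVec a₀ j⟩
    by_cases hcase : V ≤ LinearMap.ker (LinearMap.proj (Fin.last n) : (Fin (n + 1) → k) →ₗ[k] k)
    · -- Case A: every vector of `V` vanishes at the last coordinate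
      have hVeq : V = Vker := by rw [hVker]; exact (inf_eq_left.mpr hcase).symm
      refine ⟨S₀.map Fin.castSuccEmb, liftData a₀, hd₀.lift, ?_⟩
      rw [hVeq, hker_span]
    · -- Case B: there is `w ∈ V` with `w last = 1`
      obtain ⟨w, hwV, hw1⟩ : ∃ w ∈ V, w (Fin.last n) = 1 := by
        simp only [SetLike.le_def, LinearMap.mem_ker, LinearMap.coe_proj, Function.eval,
          not_forall, exists_prop] at hcase
        obtain ⟨w, hwV, hw0⟩ := hcase
        refine ⟨(w (Fin.last n))⁻¹ • w, V.smul_mem _ hwV, ?_⟩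
        simp [hw0]
      -- reduce `w` against the pivots of `Vker`
      set w₁ : Fin (n + 1) → k :=
        w - ∑ j ∈ S₀, w (Fin.castSucc j) • extendLast n (echelonVec a₀ j) with hw₁
      have hext_mem : ∀ j ∈ S₀, extendLast n (echelonVec a₀ j) ∈ Vker := by
        intro j hj
        rw [hker_span]
        refine Submodule.subset_span ⟨Fin.castSucc j, ?_, (extendLast_echelonVec a₀ j).symm⟩
        simp [hj]
      have hw₁V : w₁ ∈ V := by
        refine V.sub_mem hwV (V.sum_mem fun j hj => V.smul_mem _ ?_)
        exact ((hmemker _).mp (hext_mem j hj)).1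
      have hw₁last : w₁ (Fin.last n) = 1 := by
        simp [hw₁, hw1, Finset.sum_apply]
      have hw₁piv : ∀ j ∈ S₀, w₁ (Fin.castSucc j) = 0 := by
        intro j hj
        simp only [hw₁, Pi.sub_apply, Finset.sum_apply, Pi.smul_apply, extendLast_apply_castSucc,
          smul_eq_mul]
        rw [Finset.sum_eq_single j]
        · rw [echelonVec_apply_self, mul_one, sub_self]
        · intro j' _ hj'
          rw [hd₀.echelonVec_apply_of_mem j' hj, if_neg (Ne.symm hj'), mul_zero]
        · intro h; exact absurd hj h
      -- the new data
      let a : Fin (n + 1) → Fin (n + 1) → k := fun i j =>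
        if j = Fin.last n then (if i = Fin.last n then 0 else w₁ i) else liftData a₀ i j
      have ha_last : echelonVec a (Fin.last n) = w₁ := by
        ext i
        by_cases hi : i = Fin.last n
        · rw [hi, echelonVec_apply_self, hw₁last]
        · rw [echelonVec_apply_of_ne _ hi]
          simp [a, hi]
      have ha_cs : ∀ j : Fin n,
          echelonVec a (Fin.castSucc j) = echelonVec (liftData a₀) (Fin.castSucc j) := by
        intro j
        ext i
        by_cases hi : i = Fin.castSucc j
        · rw [hi, echelonVec_apply_self, echelonVec_apply_self]
        · rw [echelonVec_apply_of_ne _ hi, echelonVec_apply_of_ne _ hi]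
          simp [a, (Fin.castSucc_lt_last j).ne]
      refine ⟨insert (Fin.last n) (S₀.map Fin.castSuccEmb), a, ?_, ?_⟩
      · -- echelon data
        intro i j hij
        by_cases hj : j = Fin.last n
        · subst hj
          have hi : i ≠ Fin.last n := by
            rintro rfl; simp [a] at hij
          simp only [a, if_pos rfl, if_neg hi] at hij
          refine ⟨Fin.lt_last_iff_ne_last.mpr hi, ?_, Finset.mem_insert_self _ _⟩
          rw [Finset.mem_insert, not_or]
          refine ⟨hi, fun him => ?_⟩
          rw [Finset.mem_map] at him
          obtain ⟨i', hi', rfl⟩ := him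
          exact hij (hw₁piv i' hi')
        · have hij' : liftData a₀ i j ≠ 0 := by simpa [a, hj] using hij
          obtain ⟨h1, h2, h3⟩ := hd₀.lift i j hij'
          refine ⟨h1, ?_, Finset.mem_insert_of_mem h3⟩
          rw [Finset.mem_insert, not_or]
          exact ⟨fun hil => by rw [hil, liftData_last_left] at hij'; exact hij' rfl, h2⟩
      · -- span
        apply le_antisymm
        · rw [Submodule.span_le]
          rintro _ ⟨j, hj, rfl⟩
          rw [Finset.coe_insert, Set.mem_insert_iff] at hj
          rcases hj with rfl | hj
          · rw [ha_last]; exact hw₁V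
          · rw [Finset.coe_map] at hj
            obtain ⟨j', hj', rfl⟩ := hj
            change echelonVec a (Fin.castSucc j') ∈ V
            rw [ha_cs j', ← extendLast_echelonVec]
            exact ((hmemker _).mp (hext_mem j' hj')).1
        · intro x hx
          have hsplit : x = (x - x (Fin.last n) • w₁) + x (Fin.last n) • w₁ := by abel
          rw [hsplit]
          refine Submodule.add_mem _ ?_ (Submodule.smul_mem _ _ (Submodule.subset_span
            ⟨Fin.last n, by simp, ha_last⟩))
          have hxker : x - x (Fin.last n) • w₁ ∈ Vker := by
            rw [hmemker]
            exact ⟨V.sub_mem hx (V.smul_mem _ hw₁V), by simp [hw₁last]⟩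
          rw [hker_span] at hxker
          refine Submodule.span_mono ?_ hxker
          rintro _ ⟨j, hj, rfl⟩
          rw [Finset.coe_map] at hj
          obtain ⟨j', hj', rfl⟩ := hj
          refine ⟨Fin.castSucc j', ?_, ha_cs j'⟩
          rw [Finset.coe_insert, Set.mem_insert_iff]
          right
          rw [Finset.coe_map]
          exact ⟨j', hj', rfl⟩

/-- **Reduced echelon bases**, packaged: pivots `S` and coefficients `a` with `V = span {v_j : j ∈
S}`, the `v_j` linearly independent and `#S = dim V`. [folklore] -/
theorem exists_echelon_basis (V : Submodule k (Fin n → k)) :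
    ∃ (S : Finset (Fin n)) (a : Fin n → Fin n → k), IsEchelonData S a ∧
      Submodule.span k (echelonVec a '' (S : Set (Fin n))) = V ∧
      LinearIndependent k (fun j : S => echelonVec a j) ∧ S.card = Module.finrank k V := by
  obtain ⟨S, a, hd, hV⟩ := exists_isEchelonData_span_eq n V
  refine ⟨S, a, hd, hV, hd.linearIndependent, ?_⟩
  have h := finrank_span_eq_card (R := k) hd.linearIndependent
  have h2 : Set.range (fun j : S => echelonVec a j) = echelonVec a '' (S : Set (Fin n)) := by
    ext y
    simp
  rw [h2, hV, Fintype.card_coe] at h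
  exact h.symm

/-! ### Uniqueness of reduced echelon bases -/

/-- Membership in the span of the echelon vectors as a finite linear combination `∑_{j ∈ S} c_j
v_j`. [folklore] -/
theorem mem_span_image_iff {S : Finset (Fin n)} {a : Fin n → Fin n → k} {x : Fin n → k} :
    x ∈ Submodule.span k (echelonVec a '' (S : Set (Fin n))) ↔
      ∃ c : Fin n → k, ∑ j ∈ S, c j • echelonVec a j = x := by
  have h2 : echelonVec a '' (S : Set (Fin n)) = Set.range (fun j : S => echelonVec a j) := by
    ext y; simp
  rw [h2, Submodule.mem_span_range_iff_exists_fun]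
  constructor
  · rintro ⟨c, rfl⟩
    refine ⟨fun j => if hj : j ∈ S then c ⟨j, hj⟩ else 0, ?_⟩
    rw [← Finset.sum_coe_sort]
    refine Finset.sum_congr rfl fun j _ => ?_
    simp [j.2]
  · rintro ⟨c, rfl⟩
    refine ⟨fun j => c j, ?_⟩
    rw [← Finset.sum_coe_sort S]

/-- The coefficient of `v_j` in `x = ∑ c_{j'} v_{j'}` is the pivot coordinate `x_j`. [folklore] -/
theorem IsEchelonData.apply_eq_coeff {S : Finset (Fin n)} {a : Fin n → Fin n → k}
    (h : IsEchelonData S a) (c : Fin n → k) {j : Fin n} (hj : j ∈ S) :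
    (∑ j' ∈ S, c j' • echelonVec a j') j = c j := by
  simp only [Finset.sum_apply, Pi.smul_apply, smul_eq_mul]
  rw [Finset.sum_eq_single j]
  · simp
  · intro j' _ hj'
    rw [h.echelonVec_apply_of_mem j' hj, if_neg (Ne.symm hj'), mul_zero]
  · intro hjS; exact absurd hj hjS

/-- A vector of `V` vanishing at all pivots is zero. [folklore] -/
theorem IsEchelonData.eq_zero_of_forall_pivot {S : Finset (Fin n)} {a : Fin n → Fin n → k}
    (h : IsEchelonData S a) {x : Fin n → k}
    (hx : x ∈ Submodule.span k (echelonVec a '' (S : Set (Fin n)))) (h0 : ∀ j ∈ S, x j = 0) :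
    x = 0 := by
  obtain ⟨c, rfl⟩ := mem_span_image_iff.mp hx
  refine Finset.sum_eq_zero fun j hj => ?_
  have := h0 j hj
  rw [h.apply_eq_coeff c hj] at this
  rw [this, zero_smul]

/-- **Pivots are intrinsic**: `j` is a pivot iff `V` contains a vector with `x_j = 1` vanishing at
all coordinates beyond `j` (i.e. iff `j` is the last non-zero coordinate of some vector of
`V`). [folklore] -/
theorem IsEchelonData.mem_iff {S : Finset (Fin n)} {a : Fin n → Fin n → k} (h : IsEchelonData S a)
    (j : Fin n) :
    j ∈ S ↔ ∃ x ∈ Submodule.span k (echelonVec a '' (S : Set (Fin n))),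
      x j = 1 ∧ ∀ i, j < i → x i = 0 := by
  constructor
  · intro hj
    refine ⟨echelonVec a j, Submodule.subset_span ⟨j, hj, rfl⟩, echelonVec_apply_self a j,
      fun i hi => ?_⟩
    rw [echelonVec_apply_of_ne _ hi.ne', h.apply_eq_zero_of_le hi.le]
  · rintro ⟨x, hx, hx1, hx0⟩
    by_contra hjS
    obtain ⟨c, rfl⟩ := mem_span_image_iff.mp hx
    have hc : ∀ j' ∈ S, j < j' → c j' = 0 := fun j' hj' hlt => by
      rw [← h.apply_eq_coeff c hj']
      exact hx0 j' hlt
    have : (∑ j' ∈ S, c j' • echelonVec a j') j = 0 := by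
      simp only [Finset.sum_apply, Pi.smul_apply, smul_eq_mul]
      refine Finset.sum_eq_zero fun j' hj' => ?_
      have hne : j ≠ j' := fun e => hjS (e ▸ hj')
      rw [echelonVec_apply_of_ne _ hne]
      rcases lt_or_gt_of_ne hne with hlt | hgt
      · rw [hc j' hj' hlt, zero_mul]
      · rw [h.apply_eq_zero_of_le hgt.le, mul_zero]
    rw [this] at hx1
    exact zero_ne_one hx1

/-- **Uniqueness of the reduced echelon basis**: two echelon data spanning the same subspace have
the same pivots and the same coefficient table (Hoffman–Kunze §2.5, uniqueness of the
row-reduced echelon form). [folklore] -/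
theorem IsEchelonData.unique {S S' : Finset (Fin n)} {a a' : Fin n → Fin n → k}
    (h : IsEchelonData S a) (h' : IsEchelonData S' a')
    (hV : Submodule.span k (echelonVec a '' (S : Set (Fin n))) =
      Submodule.span k (echelonVec a' '' (S' : Set (Fin n)))) : S = S' ∧ a = a' := by
  have hS : S = S' := by
    ext j
    rw [h.mem_iff, h'.mem_iff, hV]
  subst hS
  refine ⟨rfl, funext fun i => funext fun j => ?_⟩
  by_cases hj : j ∈ S
  · by_cases hij : i = j
    · subst hij
      rw [h.apply_eq_zero_of_le le_rfl, h'.apply_eq_zero_of_le le_rfl]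
    · have hdiff : echelonVec a j - echelonVec a' j = 0 := by
        refine h.eq_zero_of_forall_pivot (Submodule.sub_mem _ (Submodule.subset_span ⟨j, hj, rfl⟩)
          ?_) fun j' hj' => ?_
        · rw [hV]; exact Submodule.subset_span ⟨j, hj, rfl⟩
        · rw [Pi.sub_apply, h.echelonVec_apply_of_mem j hj', h'.echelonVec_apply_of_mem j hj',
            sub_self]
      have := congrFun hdiff i
      rwa [Pi.sub_apply, Pi.zero_apply, sub_eq_zero, echelonVec_apply_of_ne _ hij,
        echelonVec_apply_of_ne _ hij] at this
  · have h1 : a i j = 0 := by by_contra hne; exact hj (h i j hne).2.2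
    have h2 : a' i j = 0 := by by_contra hne; exact hj (h' i j hne).2.2
    rw [h1, h2]

end Literature.LinearAlgebra.Matrix.Echelon
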